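import Mathlib
import HarnessLib
import Summits.Ventures.LatticeQCDFlow.Exactness.IMHDelayedRejectionExact
import Summits.Ventures.LatticeQCDFlow.Exactness.AdjointKernels

/-!
# LatticeQCDFlow / Exactness — GLOBAL FLOW DRAW FIRST, LOCAL REPAIR SECOND: delayed rejection whose second stage is ANY move reversible for
# the flow law (a latent partial refresh, a small latent step through the flow), priced by the Tierney–Mira ratio WITHOUT any proposal
# density, is exact on a general state space

HONEST FRAMING: exact (Metropolis-corrected) sampling algorithms for lattice gauge theory;
figures of merit are autocorrelation/cost numbers at stated couplings and volumes; no
continuum-physics claim.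

Venture `LatticeQCDFlow` (cell pub-lqcd), topic `Exactness`, FANOUT row 30 (lean-1 GEN-43; joins part I — SECOND CHANCES,
`IMHDelayedRejectionExact` — and part II — MOVES IN FLOW SPACE, `IMHReversibleFlowProposals`).  NEW WORK of the cell; no definition is
introduced, nothing is cited as a fact.  Tree inputs: `IMHDelayedRejectionExact` (`drSecond_flux_symm`, `drSecond_le_one_sub`: the
second-stage product density `d(x, y₁, z) = min(1 − a(x, y₁), w(z)(1 − a(z, y₁))/w(x))` and its flux symmetry), `AdjointKernels`
(`IsAdjointPair.lintegral_swap`).  Printed counterparts NAMED ONLY: Tierney–Mira 1999 §4; Green–Mira 2001 (second-stage proposals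
"reversible with respect to a reference measure" need no density in the ratio).

## The sampler (general measurable `Ω`; flow law `q`; weight `w > 0`; `π = w·q`; `R` a Markov kernel REVERSIBLE FOR `q`)

From `x`: draw `y₁ ∼ q` (a GLOBAL, independent flow draw), accept with `a(x, y₁) = min(1, w(y₁)/w(x))`; if rejected, make a LOCAL
flow-space move `z ∼ R(x, ·)` and accept it with the Tierney–Mira probability `min(1, w(z)(1 − a(z, y₁)) / (w(x)(1 − a(x, y₁))))` — the
same ratio as for a second independent draw (`IMHDelayedRejectionExact`): `R`'s asymmetry is balanced by `q`, so NO density of `R`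
appears; else stay.  Def-free: ANY kernel `K` with
`K(x, B) = ∫_B a dq + ∫ (∫_B d(x, y₁, z) R(x, dz)) q(dy₁) + (1 − m(x))·1_B(x)`, `m(x) = A(x) + ∫∫ d(x, y₁, z) R(x, dz) q(dy₁)` (hypothesis `hK`).

## Results [all ours]

* `measurable_drSecond_comp` (bookkeeping along any parametrisation), `drMassR_le_one` ∕ `drR_apply_univ` (the kernel is Markov).
* `drR_secondFlux_symm`: for each rejected draw `y₁`, the second-stage flux
  `Ψ_{y₁}(A, B) = ∫∫ 1_A(x)1_B(z) w(x)d(x, y₁, z) R(x, dz) q(dx)` is symmetric in `A ↔ B` (flux symmetry of `d` under `x ↔ z` + the functional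
  form of `q`-reversibility of `R`).
* `drR_setLIntegral`: the mass flow `∫_A K(x, B) dπ` = first-stage flux + `∫ Ψ_{y₁}(A, B) q(dy₁)` + a diagonal term.
* **`delayedRejectionR_isReversible` ∕ `delayedRejectionR_invariant`**: EVERY such `K` is `π`-reversible and leaves `π = w·q` invariant — for
  every flow, weight and `q`-reversible local move `R`.  With `R = q` this is `IMHDelayedRejectionExact` again (`const` is `q`-reversible).
-/

namespace Summit.Ventures.LatticeQCDFlow.Exactness

open MeasureTheory ProbabilityTheory
open scoped ENNReal

variable {Ω : Type*} [MeasurableSpace Ω] {q : Measure Ω} [IsProbabilityMeasure q] {w : Ω → ℝ}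

/-! ## §1 Bookkeeping -/

/-- Measurability of the second-stage product density along any measurable parametrisation `t ↦ (X t, Y t, Z t)` of (current state, rejected
draw, second-stage point). [ours, bookkeeping] -/
theorem measurable_drSecond_comp {α : Type*} [MeasurableSpace α] {X Y Z : α → Ω} (hw : Measurable w)
    (hX : Measurable X) (hY : Measurable Y) (hZ : Measurable Z) :
    Measurable fun t => ENNReal.ofReal (min (1 - imhAccept w (X t) (Y t)) (w (Z t) * (1 - imhAccept w (Z t) (Y t)) / w (X t))) := by
  unfold imhAccept
  have h1 : Measurable fun t => w (X t) := hw.comp hX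
  have h2 : Measurable fun t => w (Y t) := hw.comp hY
  have h3 : Measurable fun t => w (Z t) := hw.comp hZ
  exact ((measurable_const.sub (measurable_const.min (h2.div h1))).min
    ((h3.mul (measurable_const.sub (measurable_const.min (h2.div h3)))).div h1)).ennreal_ofReal

/-- Measurability of `(x, y₁) ↦ ∫_B d(x, y₁, z) R(x, dz)` (jointly). [ours, bookkeeping] -/
theorem measurable_lintegral_drSecond_kernel (hw : Measurable w) (R : Kernel Ω Ω) [IsMarkovKernel R] {B : Set Ω}
    (hB : MeasurableSet B) :
    Measurable fun p : Ω × Ω =>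
      ∫⁻ z in B, ENNReal.ofReal (min (1 - imhAccept w p.1 p.2) (w z * (1 - imhAccept w z p.2) / w p.1)) ∂(R p.1) := by
  have hf : Measurable (Function.uncurry fun (p : Ω × Ω) (z : Ω) =>
      B.indicator (fun z => ENNReal.ofReal (min (1 - imhAccept w p.1 p.2) (w z * (1 - imhAccept w z p.2) / w p.1))) z) :=
    ((measurable_drSecond_comp hw (measurable_fst.comp measurable_fst) (measurable_snd.comp measurable_fst) measurable_snd).indicator
      (measurable_snd hB) : Measurable fun r : (Ω × Ω) × Ω =>
        B.indicator (fun z => ENNReal.ofReal (min (1 - imhAccept w r.1.1 r.1.2) (w z * (1 - imhAccept w z r.1.2) / w r.1.1))) r.2)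
  have := hf.lintegral_kernel_prod_right (κ := R.comap Prod.fst measurable_fst)
  simpa only [Kernel.comap_apply, lintegral_indicator hB] using this

/-- **THE MOVE MASS IS AT MOST ONE**: `A(x) + ∫∫ d(x, y₁, z) R(x, dz) q(dy₁) ≤ 1`. [ours] -/
theorem drMassR_le_one (hw : Measurable w) (hw0 : ∀ x, 0 < w x) (R : Kernel Ω Ω) [IsMarkovKernel R] (x : Ω) :
    imhAcceptMass q w x +
      ∫⁻ y₁, ∫⁻ z, ENNReal.ofReal (min (1 - imhAccept w x y₁) (w z * (1 - imhAccept w z y₁) / w x)) ∂(R x) ∂q ≤ 1 := by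
  have ha : Measurable fun y => imhAcceptE w x y := (measurable_imhAcceptE hw).of_uncurry_left
  calc imhAcceptMass q w x +
        ∫⁻ y₁, ∫⁻ z, ENNReal.ofReal (min (1 - imhAccept w x y₁) (w z * (1 - imhAccept w z y₁) / w x)) ∂(R x) ∂q
      ≤ imhAcceptMass q w x + ∫⁻ y₁, ∫⁻ _z, (1 - imhAcceptE w x y₁) ∂(R x) ∂q := by
        gcongr with y₁ z
        exact drSecond_le_one_sub hw0 x y₁ z
    _ = ∫⁻ y₁, imhAcceptE w x y₁ ∂q + ∫⁻ y₁, (1 - imhAcceptE w x y₁) ∂q := by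
        simp only [imhAcceptMass, lintegral_const, measure_univ, mul_one]
    _ = ∫⁻ y₁, (imhAcceptE w x y₁ + (1 - imhAcceptE w x y₁)) ∂q := (lintegral_add_left ha _).symm
    _ = ∫⁻ _y₁, 1 ∂q := lintegral_congr fun y₁ => add_tsub_cancel_of_le (imhAcceptE_le_one w x y₁)
    _ = 1 := by rw [lintegral_const, measure_univ, mul_one]

/-- `K(x, Ω) = 1`. [ours] -/
theorem drR_apply_univ (hw : Measurable w) (hw0 : ∀ x, 0 < w x) (R : Kernel Ω Ω) [IsMarkovKernel R] (K : Kernel Ω Ω)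
    (hK : ∀ (x : Ω) {B : Set Ω}, MeasurableSet B → K x B =
      ∫⁻ y in B, imhAcceptE w x y ∂q +
        ∫⁻ y₁, ∫⁻ z in B, ENNReal.ofReal (min (1 - imhAccept w x y₁) (w z * (1 - imhAccept w z y₁) / w x)) ∂(R x) ∂q +
        (1 - (imhAcceptMass q w x +
          ∫⁻ y₁, ∫⁻ z, ENNReal.ofReal (min (1 - imhAccept w x y₁) (w z * (1 - imhAccept w z y₁) / w x)) ∂(R x) ∂q)) *
          B.indicator 1 x)
    (x : Ω) : K x Set.univ = 1 := by
  rw [hK x MeasurableSet.univ]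
  simp only [Measure.restrict_univ, Set.indicator_univ, Pi.one_apply, mul_one]
  rw [show ∫⁻ y, imhAcceptE w x y ∂q = imhAcceptMass q w x from rfl]
  exact add_tsub_cancel_of_le (drMassR_le_one hw hw0 R x)

/-- Hence `K` is Markov. [ours, bookkeeping] -/
theorem drR_isMarkovKernel (hw : Measurable w) (hw0 : ∀ x, 0 < w x) (R : Kernel Ω Ω) [IsMarkovKernel R] (K : Kernel Ω Ω)
    (hK : ∀ (x : Ω) {B : Set Ω}, MeasurableSet B → K x B =
      ∫⁻ y in B, imhAcceptE w x y ∂q +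
        ∫⁻ y₁, ∫⁻ z in B, ENNReal.ofReal (min (1 - imhAccept w x y₁) (w z * (1 - imhAccept w z y₁) / w x)) ∂(R x) ∂q +
        (1 - (imhAcceptMass q w x +
          ∫⁻ y₁, ∫⁻ z, ENNReal.ofReal (min (1 - imhAccept w x y₁) (w z * (1 - imhAccept w z y₁) / w x)) ∂(R x) ∂q)) *
          B.indicator 1 x) :
    IsMarkovKernel K :=
  ⟨fun x => ⟨drR_apply_univ hw hw0 R K hK x⟩⟩

/-! ## §2 The second-stage flux for a fixed rejected draw is symmetric -/

/-- Joint measurability of the rectangle second-stage flux integrand `1_A(x)·1_B(z)·w(x)d(x, y₁, z)` in `(x, z)`. [ours, bookkeeping] -/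
theorem measurable_rectSecondFlux (hw : Measurable w) (y₁ : Ω) {A B : Set Ω} (hA : MeasurableSet A) (hB : MeasurableSet B) :
    Measurable (Function.uncurry fun x z : Ω => A.indicator (fun _ => (1 : ℝ≥0∞)) x *
      B.indicator (fun z => ENNReal.ofReal (w x) *
        ENNReal.ofReal (min (1 - imhAccept w x y₁) (w z * (1 - imhAccept w z y₁) / w x))) z) := by
  have hG : Measurable fun p : Ω × Ω => ENNReal.ofReal (w p.1) *
      ENNReal.ofReal (min (1 - imhAccept w p.1 y₁) (w p.2 * (1 - imhAccept w p.2 y₁) / w p.1)) :=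
    (hw.comp measurable_fst).ennreal_ofReal.mul (measurable_drSecond_comp hw measurable_fst measurable_const measurable_snd)
  exact ((measurable_const.indicator hA).comp measurable_fst).mul
    (hG.indicator (measurable_snd hB) : Measurable fun p : Ω × Ω => B.indicator (fun z => ENNReal.ofReal (w p.1) *
      ENNReal.ofReal (min (1 - imhAccept w p.1 y₁) (w z * (1 - imhAccept w z y₁) / w p.1))) p.2)

/-- **THE SECOND-STAGE FLUX IS SYMMETRIC FOR EACH REJECTED DRAW**: `Ψ_{y₁}(A, B) = Ψ_{y₁}(B, A)`. [ours] -/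
theorem drR_secondFlux_symm (hw : Measurable w) (hw0 : ∀ x, 0 < w x) (R : Kernel Ω Ω) [IsMarkovKernel R]
    (hR : Kernel.IsReversible R q) (y₁ : Ω) {A B : Set Ω} (hA : MeasurableSet A) (hB : MeasurableSet B) :
    ∫⁻ x, ∫⁻ z, A.indicator (fun _ => (1 : ℝ≥0∞)) x * B.indicator (fun z => ENNReal.ofReal (w x) *
        ENNReal.ofReal (min (1 - imhAccept w x y₁) (w z * (1 - imhAccept w z y₁) / w x))) z ∂(R x) ∂q =
      ∫⁻ x, ∫⁻ z, B.indicator (fun _ => (1 : ℝ≥0∞)) x * A.indicator (fun z => ENNReal.ofReal (w x) *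
        ENNReal.ofReal (min (1 - imhAccept w x y₁) (w z * (1 - imhAccept w z y₁) / w x))) z ∂(R x) ∂q := by
  rw [(hR.isAdjointPair).lintegral_swap (measurable_rectSecondFlux hw y₁ hA hB)]
  refine lintegral_congr fun z => lintegral_congr fun x => ?_
  by_cases hx : x ∈ A
  · by_cases hz : z ∈ B
    · simp only [Set.indicator_of_mem hx, Set.indicator_of_mem hz, one_mul]
      exact drSecond_flux_symm hw0 x y₁ z
    · simp only [Set.indicator_of_notMem hz, mul_zero, zero_mul]
  · simp only [Set.indicator_of_notMem hx, zero_mul, mul_zero]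

/-! ## §3 The mass flow: first-stage flux, second-stage flux integrated over the rejected draw, diagonal -/

/-- Pointwise: `w(x)·∫_B d(x, y₁, z) R(x, dz) = ∫ 1_B(z)·w(x)d(x, y₁, z) R(x, dz)`. [ours, bookkeeping] -/
theorem drR_inner_eq (hw : Measurable w) (R : Kernel Ω Ω) (x y₁ : Ω) {B : Set Ω} (hB : MeasurableSet B) :
    ENNReal.ofReal (w x) * ∫⁻ z in B, ENNReal.ofReal (min (1 - imhAccept w x y₁) (w z * (1 - imhAccept w z y₁) / w x)) ∂(R x) =
      ∫⁻ z, B.indicator (fun z => ENNReal.ofReal (w x) *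
        ENNReal.ofReal (min (1 - imhAccept w x y₁) (w z * (1 - imhAccept w z y₁) / w x))) z ∂(R x) := by
  have hm : Measurable fun z => ENNReal.ofReal (min (1 - imhAccept w x y₁) (w z * (1 - imhAccept w z y₁) / w x)) :=
    measurable_drSecond_comp hw measurable_const measurable_const measurable_id
  rw [← lintegral_indicator hB, ← lintegral_const_mul _ (hm.indicator hB)]
  refine lintegral_congr fun z => ?_
  by_cases hz : z ∈ B
  · simp only [Set.indicator_of_mem hz]
  · simp only [Set.indicator_of_notMem hz, mul_zero]

/-- **THE SECOND-STAGE PART OF THE MASS FLOW** is the `q`-average over the rejected draw of the rectangle fluxes `Ψ_{y₁}(A, B)`. [ours] -/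
theorem drR_second_eq (hw : Measurable w) (R : Kernel Ω Ω) [IsMarkovKernel R] {A B : Set Ω} (hA : MeasurableSet A)
    (hB : MeasurableSet B) :
    ∫⁻ x in A, ENNReal.ofReal (w x) *
        ∫⁻ y₁, ∫⁻ z in B, ENNReal.ofReal (min (1 - imhAccept w x y₁) (w z * (1 - imhAccept w z y₁) / w x)) ∂(R x) ∂q ∂q =
      ∫⁻ y₁, ∫⁻ x, ∫⁻ z, A.indicator (fun _ => (1 : ℝ≥0∞)) x * B.indicator (fun z => ENNReal.ofReal (w x) *
        ENNReal.ofReal (min (1 - imhAccept w x y₁) (w z * (1 - imhAccept w z y₁) / w x))) z ∂(R x) ∂q ∂q := by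
  have hJ := measurable_lintegral_drSecond_kernel hw R hB
  have hJx : ∀ x, Measurable fun y₁ =>
      ∫⁻ z in B, ENNReal.ofReal (min (1 - imhAccept w x y₁) (w z * (1 - imhAccept w z y₁) / w x)) ∂(R x) :=
    fun x => hJ.comp (measurable_const.prodMk measurable_id)
  have hF : Measurable (Function.uncurry fun x y₁ : Ω => A.indicator (fun _ => (1 : ℝ≥0∞)) x * (ENNReal.ofReal (w x) *
      ∫⁻ z in B, ENNReal.ofReal (min (1 - imhAccept w x y₁) (w z * (1 - imhAccept w z y₁) / w x)) ∂(R x))) :=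
    ((measurable_const.indicator hA).comp measurable_fst).mul ((hw.comp measurable_fst).ennreal_ofReal.mul hJ)
  rw [← lintegral_indicator hA]
  have hpt : ∀ x, A.indicator (fun x => ENNReal.ofReal (w x) *
      ∫⁻ y₁, ∫⁻ z in B, ENNReal.ofReal (min (1 - imhAccept w x y₁) (w z * (1 - imhAccept w z y₁) / w x)) ∂(R x) ∂q) x =
      ∫⁻ y₁, A.indicator (fun _ => (1 : ℝ≥0∞)) x * (ENNReal.ofReal (w x) *
        ∫⁻ z in B, ENNReal.ofReal (min (1 - imhAccept w x y₁) (w z * (1 - imhAccept w z y₁) / w x)) ∂(R x)) ∂q := by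
    intro x
    by_cases hx : x ∈ A
    · simp only [Set.indicator_of_mem hx, one_mul]
      rw [lintegral_const_mul _ (hJx x)]
    · simp only [Set.indicator_of_notMem hx, zero_mul, lintegral_zero]
  simp_rw [hpt]
  rw [lintegral_lintegral_swap (hF.aemeasurable (μ := q.prod q))]
  refine lintegral_congr fun y₁ => lintegral_congr fun x => ?_
  by_cases hx : x ∈ A
  · simp only [Set.indicator_of_mem hx, one_mul]
    exact drR_inner_eq hw R x y₁ hB
  · simp only [Set.indicator_of_notMem hx, zero_mul, lintegral_zero]

omit [IsProbabilityMeasure q] in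
/-- The first-stage flux `∫_A ∫_B min(w x, w y) q(dy) q(dx)` is symmetric (the plain sampler's detailed balance). [ours, bookkeeping] -/
theorem firstFlux_symm [SFinite q] (hw : Measurable w) {A B : Set Ω} :
    ∫⁻ x in A, ∫⁻ y in B, ENNReal.ofReal (min (w x) (w y)) ∂q ∂q = ∫⁻ x in B, ∫⁻ y in A, ENNReal.ofReal (min (w x) (w y)) ∂q ∂q := by
  have hs : Measurable (Function.uncurry fun x y : Ω => ENNReal.ofReal (min (w x) (w y))) :=
    ((hw.comp measurable_fst).min (hw.comp measurable_snd)).ennreal_ofReal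
  rw [lintegral_lintegral_swap (hs.aemeasurable (μ := (q.restrict A).prod (q.restrict B)))]
  refine lintegral_congr fun y => lintegral_congr fun x => ?_
  rw [min_comm]

/-- **THE MASS-FLOW SPLIT**: `∫_A K(x, B) dπ = ∫_A∫_B min(w x, w y) + ∫ Ψ_{y₁}(A, B) q(dy₁) + ∫_{B ∩ A} w(x)(1 − m(x)) q(dx)`. [ours] -/
theorem drR_setLIntegral (hw : Measurable w) (hw0 : ∀ x, 0 < w x) (R : Kernel Ω Ω) [IsMarkovKernel R] (K : Kernel Ω Ω)
    (hK : ∀ (x : Ω) {B : Set Ω}, MeasurableSet B → K x B =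
      ∫⁻ y in B, imhAcceptE w x y ∂q +
        ∫⁻ y₁, ∫⁻ z in B, ENNReal.ofReal (min (1 - imhAccept w x y₁) (w z * (1 - imhAccept w z y₁) / w x)) ∂(R x) ∂q +
        (1 - (imhAcceptMass q w x +
          ∫⁻ y₁, ∫⁻ z, ENNReal.ofReal (min (1 - imhAccept w x y₁) (w z * (1 - imhAccept w z y₁) / w x)) ∂(R x) ∂q)) *
          B.indicator 1 x)
    {A B : Set Ω} (hA : MeasurableSet A) (hB : MeasurableSet B) :
    ∫⁻ x in A, K x B ∂(q.withDensity fun x => ENNReal.ofReal (w x)) =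
      (∫⁻ x in A, ∫⁻ y in B, ENNReal.ofReal (min (w x) (w y)) ∂q ∂q) +
      (∫⁻ y₁, ∫⁻ x, ∫⁻ z, A.indicator (fun _ => (1 : ℝ≥0∞)) x * B.indicator (fun z => ENNReal.ofReal (w x) *
        ENNReal.ofReal (min (1 - imhAccept w x y₁) (w z * (1 - imhAccept w z y₁) / w x))) z ∂(R x) ∂q ∂q) +
      ∫⁻ x in B ∩ A, ENNReal.ofReal (w x) * (1 - (imhAcceptMass q w x +
        ∫⁻ y₁, ∫⁻ z, ENNReal.ofReal (min (1 - imhAccept w x y₁) (w z * (1 - imhAccept w z y₁) / w x)) ∂(R x) ∂q)) ∂q := by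
  have hd : Measurable fun x => ENNReal.ofReal (w x) := hw.ennreal_ofReal
  have hKm : Measurable fun x => K x B := Kernel.measurable_coe _ hB
  have ha : Measurable (Function.uncurry (imhAcceptE w)) := measurable_imhAcceptE hw
  have hI1 : Measurable fun x => ∫⁻ y in B, imhAcceptE w x y ∂q := by
    have : Measurable fun x => ∫⁻ y, B.indicator (fun y => imhAcceptE w x y) y ∂q :=
      (Measurable.indicator ha (measurable_snd hB) :
        Measurable fun p : Ω × Ω => B.indicator (fun y => imhAcceptE w p.1 y) p.2).lintegral_prod_right'
    simpa only [lintegral_indicator hB] using this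
  have hM : Measurable fun x => imhAcceptMass q w x +
      ∫⁻ y₁, ∫⁻ z, ENNReal.ofReal (min (1 - imhAccept w x y₁) (w z * (1 - imhAccept w z y₁) / w x)) ∂(R x) ∂q := by
    have h : Measurable fun x =>
        ∫⁻ y₁, ∫⁻ z in Set.univ, ENNReal.ofReal (min (1 - imhAccept w x y₁) (w z * (1 - imhAccept w z y₁) / w x)) ∂(R x) ∂q :=
      (measurable_lintegral_drSecond_kernel hw R MeasurableSet.univ).lintegral_prod_right'
    simp only [Measure.restrict_univ] at h
    exact (measurable_imhAcceptMass q hw).add h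
  have hRm : Measurable fun x => 1 - (imhAcceptMass q w x +
      ∫⁻ y₁, ∫⁻ z, ENNReal.ofReal (min (1 - imhAccept w x y₁) (w z * (1 - imhAccept w z y₁) / w x)) ∂(R x) ∂q) :=
    measurable_const.sub hM
  rw [setLIntegral_withDensity_eq_setLIntegral_mul _ hd hKm hA]
  simp only [Pi.mul_apply]
  have hpt : ∀ x, ENNReal.ofReal (w x) * K x B =
      ENNReal.ofReal (w x) * ∫⁻ y in B, imhAcceptE w x y ∂q +
        ENNReal.ofReal (w x) *
          ∫⁻ y₁, ∫⁻ z in B, ENNReal.ofReal (min (1 - imhAccept w x y₁) (w z * (1 - imhAccept w z y₁) / w x)) ∂(R x) ∂q +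
        B.indicator (fun x => ENNReal.ofReal (w x) * (1 - (imhAcceptMass q w x +
          ∫⁻ y₁, ∫⁻ z, ENNReal.ofReal (min (1 - imhAccept w x y₁) (w z * (1 - imhAccept w z y₁) / w x)) ∂(R x) ∂q))) x := by
    intro x
    rw [hK x hB, mul_add, mul_add]
    congr 1
    by_cases hx : x ∈ B
    · rw [Set.indicator_of_mem hx, Set.indicator_of_mem hx, Pi.one_apply, mul_one]
    · rw [Set.indicator_of_notMem hx, Set.indicator_of_notMem hx, mul_zero, mul_zero]
  simp_rw [hpt]
  have hind : Measurable (B.indicator fun x => ENNReal.ofReal (w x) * (1 - (imhAcceptMass q w x +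
      ∫⁻ y₁, ∫⁻ z, ENNReal.ofReal (min (1 - imhAccept w x y₁) (w z * (1 - imhAccept w z y₁) / w x)) ∂(R x) ∂q))) :=
    (show Measurable fun x => ENNReal.ofReal (w x) * (1 - (imhAcceptMass q w x +
      ∫⁻ y₁, ∫⁻ z, ENNReal.ofReal (min (1 - imhAccept w x y₁) (w z * (1 - imhAccept w z y₁) / w x)) ∂(R x) ∂q)) from
      hd.mul hRm).indicator hB
  have h1m : Measurable fun x => ENNReal.ofReal (w x) * ∫⁻ y in B, imhAcceptE w x y ∂q := hd.mul hI1
  rw [lintegral_add_right _ hind, lintegral_add_left h1m, lintegral_indicator hB, Measure.restrict_restrict hB,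
    drR_second_eq hw R hA hB]
  congr 1; congr 1
  refine lintegral_congr fun x => ?_
  rw [← lintegral_const_mul _ (ha.of_uncurry_left)]
  exact lintegral_congr fun y => ofReal_mul_imhAcceptE hw0 x y

/-! ## §4 Exactness -/

/-- **GLOBAL FLOW DRAW FIRST, LOCAL REVERSIBLE REPAIR SECOND — DETAILED BALANCE.**  For every flow law `q`, positive measurable weight
`w`, Markov kernel `R` reversible for `q`, and ANY kernel `K` realising the two-stage rule with the Tierney–Mira price, `K` is reversible
for `π = w·q`. [ours] -/
theorem delayedRejectionR_isReversible (hw : Measurable w) (hw0 : ∀ x, 0 < w x) (R : Kernel Ω Ω) [IsMarkovKernel R]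
    (hR : Kernel.IsReversible R q) (K : Kernel Ω Ω)
    (hK : ∀ (x : Ω) {B : Set Ω}, MeasurableSet B → K x B =
      ∫⁻ y in B, imhAcceptE w x y ∂q +
        ∫⁻ y₁, ∫⁻ z in B, ENNReal.ofReal (min (1 - imhAccept w x y₁) (w z * (1 - imhAccept w z y₁) / w x)) ∂(R x) ∂q +
        (1 - (imhAcceptMass q w x +
          ∫⁻ y₁, ∫⁻ z, ENNReal.ofReal (min (1 - imhAccept w x y₁) (w z * (1 - imhAccept w z y₁) / w x)) ∂(R x) ∂q)) *
          B.indicator 1 x) :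
    Kernel.IsReversible K (q.withDensity fun x => ENNReal.ofReal (w x)) := by
  intro A B hA hB
  rw [drR_setLIntegral hw hw0 R K hK hA hB, drR_setLIntegral hw hw0 R K hK hB hA, Set.inter_comm, firstFlux_symm hw]
  congr 2
  exact lintegral_congr fun y₁ => drR_secondFlux_symm hw hw0 R hR y₁ hA hB

/-- **… INVARIANCE**: `π = w·q` is invariant under every such kernel. [ours] -/
theorem delayedRejectionR_invariant (hw : Measurable w) (hw0 : ∀ x, 0 < w x) (R : Kernel Ω Ω) [IsMarkovKernel R]
    (hR : Kernel.IsReversible R q) (K : Kernel Ω Ω)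
    (hK : ∀ (x : Ω) {B : Set Ω}, MeasurableSet B → K x B =
      ∫⁻ y in B, imhAcceptE w x y ∂q +
        ∫⁻ y₁, ∫⁻ z in B, ENNReal.ofReal (min (1 - imhAccept w x y₁) (w z * (1 - imhAccept w z y₁) / w x)) ∂(R x) ∂q +
        (1 - (imhAcceptMass q w x +
          ∫⁻ y₁, ∫⁻ z, ENNReal.ofReal (min (1 - imhAccept w x y₁) (w z * (1 - imhAccept w z y₁) / w x)) ∂(R x) ∂q)) *
          B.indicator 1 x) :
    Kernel.Invariant K (q.withDensity fun x => ENNReal.ofReal (w x)) := by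
  haveI := drR_isMarkovKernel hw hw0 R K hK
  exact (delayedRejectionR_isReversible hw hw0 R hR K hK).invariant

end Summit.Ventures.LatticeQCDFlow.Exactness
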